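import Literature.MathematicalPhysics.PowerSystems.NondegenerateEquilibriumInstability
import Literature.MathematicalPhysics.PowerSystems.LoadedRingNormalOperationCensus
import HarnessLib

/-!
# Taylor's cut-set lemma: at a stable synchronous state every cut of the network has nonnegative
# total residual capacity `Σ_{i∈S, j∉S} Cᵢⱼ cos(θᵢ − θⱼ) ≥ 0` (Taylor 2012, Lemma 2.1) — and its ring
# corollary: a stable synchronous state of a single-loop network has AT MOST ONE line with
# `|θᵢ − θⱼ| > π/2` (Delabays–Coletta–Jacquod 2016)

Topic `Literature/MathematicalPhysics/PowerSystems`, namespace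
`Literature.MathematicalPhysics.PowerSystems.ClassicalModel`. The INDICATOR TEST of the Hesse form:
for the indicator vector `1_S` of a node set the quadratic form of the Hesse matrix of the potential
equals the total residual capacity of the cut `(S, Sᶜ)` (plus the bus terms inside `S`). Consequences
on the tree's vocabulary (`LosslessSystem`, the energy route of `NonMinimumEquilibriumInstability`,
the nondegenerate route of `NondegenerateEquilibriumInstability`): a negative cut makes the state a
non-minimum of the energy, hence — when nondegenerate — an UNSTABLE rest point / synchronous
solution; on a ring two lines with negative cosine bound an arc whose cut is negative. Everything
below is PROVED (no definition, no named fact, no new axiom).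

SOURCES (read on the page this session).

* R. Taylor, *There is no non-zero stable fixed point for dense networks in the homogeneous Kuramoto
  model*, J. Phys. A 45 (2012) 055102 [TaylorKuramoto2012] (`lit read arxiv:1109.4451`, chunk p0008):
  **Lemma 2.1** «Let {θ*ᵢ} be any stable fixed point solution to the Kuramoto model. Then … for any
  non-empty node subset S, Σ_{i∈S, j∉S} Aᵢⱼ cos(θ*ⱼ − θ*ᵢ) ≥ 0», proof: «Since the system is stable,
  the matrix M is negative semi-definite … Choose z to be the vector defined by zᵢ = 1 for i ∈ S,
  while zᵢ = 0 for i ∉ S … This proves the lemma.» (stability there = the linearisation `M` is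
  negative semidefinite, i.e. the Hesse form of the potential is positive semidefinite).
* R. Delabays, T. Coletta, P. Jacquod, *Multistability of phase-locking and topological winding
  numbers in locally coupled Kuramoto models on single-loop networks*, J. Math. Phys. 57 (2016)
  032701 [DelabaysColettaJacquod2016] (`lit read arxiv:1512.04266`, chunk p0013 L19–L37):
  **Lemma 4.10 (Taylor)** restated, and: «if we can partition the nodes of the network in two sets S
  and Sᶜ, such that the sum of cosines of the angle differences on all the lines between these two
  sets is smaller than 0, then the solution is unstable. In our case of a cycle network, if the angle
  differences on two lines are larger than π/2 or less than −π/2, removing these two lines splits the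
  network in two parts, S and Sᶜ, such that Σ cos(Δᵢⱼ) < 0, and the solution is unstable. We conclude
  that there is at most a single |Δ_{i,i+1}| > π/2.»
* D. Manik, M. Timme, D. Witthaut, Chaos 27 (2017) 083123 [ManikTimmeWitthaut2017], §5.2 proof of
  Cor. 2 (p0011 L12–L35): the same indicator test on one side of a tree line,
  «v⃗ᵀMv⃗ = K^red_{ℓ,ℓ+1} < 0. Thus, the Hesse matrix is not positive semi-definite … unstable».

## What is proved

* §1 **`hessForm_indicator`** (any network, any number of infinite buses, `C` symmetric): for a node
  set `A`, `Q(θ; 1_A) = Σ_{i∈A} Σ_{j∉A} Cᵢⱼ cos(θᵢ − θⱼ) + Σ_{i∈A} Σ_b Kᵢb cos(θᵢ − β_b)`.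
* §2 TAYLOR'S LEMMA and its dynamic contrapositives: `cut_nonneg_of_hessForm_nonneg` (Lemma 2.1 as
  printed: Hesse form PSD ⇒ every cut nonnegative); `not_isLocalMin_potential_of_negative_cut` (a
  negative cut ⇒ the equilibrium is NOT a local minimum of the energy); ★
  `unstable_rest_of_negative_cut_of_nondegenerate` (any `m`: negative cut + nondegenerate Hesse
  matrix ⇒ UNSTABLE rest point of the damped swing model) and ★
  `unstable_syncSolution_of_negative_cut_of_nondegenerate` (`m = 0`: negative cut + transversally
  nondegenerate ⇒ UNSTABLE synchronous solution).
* §3 THE RING: `loadedRing_row_sum`, `loadedRing_hessForm_eq_edges` (on a ring the Hesse form is the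
  edge sum `Σₖ Kₖ cos(θₖ − θ_{ρk})(vₖ − v_{ρk})²`), `arc_indicator_sq` (the arc from `ρk₁` to `k₂` is
  cut exactly by the lines `k₁` and `k₂`), `loadedRing_hessForm_indicator_arc`
  (`Q(1_arc) = K_{k₁}cos(θ_{k₁} − θ_{ρk₁}) + K_{k₂}cos(θ_{k₂} − θ_{ρk₂})`), ★
  `loadedRing_not_isLocalMin_of_two_negative_lines` and ★★
  **`loadedRing_unstable_syncSolution_of_two_negative_lines`** — DCJ's «at most a single
  |Δ| > π/2» in contrapositive: TWO lines with negative cosine make a (transversally nondegenerate)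
  synchronous state of ANY loaded ring an UNSTABLE synchronous solution of the damped swing model.

DEVIATIONS. Taylor's and DCJ's «stable» is linear (semidefinite linearisation); the tree's dynamic
conclusions need either nothing (non-minimum of the energy, §2) or NONDEGENERACY of the Hesse matrix
(instability of the motions, via `NondegenerateEquilibriumInstability`) — the degenerate case
(a zero eigenvalue beyond the rotation) is not decided here, as in print.

THREE COLUMNS. CERTIFIED for MODEL `M` = damped lossless network-reduced swing model (any topology,
§1–§2; rings, §3; MV-1 class): structural necessary conditions for stability. NOT CLAIMED:
sufficiency (Taylor: «this condition is a necessary condition only»); degenerate equilibria;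
anything about a power system.
-/

noncomputable section

open Real Set Filter Topology Metric Finset
open scoped Matrix

namespace Literature.MathematicalPhysics.PowerSystems

namespace ClassicalModel

namespace LosslessSystem

/-! ### §1. The indicator test: `Q(θ; 1_A)` is the residual capacity of the cut `(A, Aᶜ)` -/

section AnyBus

variable {n m : ℕ} (S : LosslessSystem n m)

/-- **The Hesse form on an indicator vector is the cut's total residual capacity** (`C` symmetric):
`½ΣᵢΣⱼ Cᵢⱼ cos(θᵢ − θⱼ)(1_A(i) − 1_A(j))² + ΣᵢΣ_b Kᵢb cos(θᵢ − β_b)1_A(i)²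
= Σ_{i∈A}Σ_{j∉A} Cᵢⱼ cos(θᵢ − θⱼ) + Σ_{i∈A}Σ_b Kᵢb cos(θᵢ − β_b)` («Choose z to be the vector
defined by zᵢ = 1 for i ∈ S, while zᵢ = 0 for i ∉ S»).
[cite: TaylorKuramoto2012, §2 proof of Lemma 2.1; ManikTimmeWitthaut2017, §5.2 proof of Cor. 2 («v⃗ᵀMv⃗ = K^red_{ℓ,ℓ+1}»)] -/
theorem hessForm_indicator (hC : ∀ i j, S.C i j = S.C j i) (θ : Fin n → ℝ) (A : Finset (Fin n)) :
    1 / 2 * ∑ i, ∑ j, S.C i j * Real.cos (θ i - θ j)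
        * ((if i ∈ A then (1 : ℝ) else 0) - (if j ∈ A then (1 : ℝ) else 0)) ^ 2
      + ∑ i, ∑ b, S.K i b * Real.cos (θ i - S.β b) * (if i ∈ A then (1 : ℝ) else 0) ^ 2
    = ∑ i ∈ A, ∑ j ∈ Aᶜ, S.C i j * Real.cos (θ i - θ j)
      + ∑ i ∈ A, ∑ b, S.K i b * Real.cos (θ i - S.β b) := by
  -- the cross indicator
  have hsq : ∀ i j : Fin n, ((if i ∈ A then (1 : ℝ) else 0) - (if j ∈ A then (1 : ℝ) else 0)) ^ 2
      = (if i ∈ A then (1 : ℝ) else 0) * (if j ∈ Aᶜ then (1 : ℝ) else 0)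
        + (if j ∈ A then (1 : ℝ) else 0) * (if i ∈ Aᶜ then (1 : ℝ) else 0) := by
    intro i j
    simp only [Finset.mem_compl]
    split_ifs <;> norm_num
  -- one cross sum
  have hT : ∀ θ' : Fin n → ℝ, ∑ i, ∑ j, S.C i j * Real.cos (θ' i - θ' j)
      * ((if i ∈ A then (1 : ℝ) else 0) * (if j ∈ Aᶜ then (1 : ℝ) else 0))
      = ∑ i ∈ A, ∑ j ∈ Aᶜ, S.C i j * Real.cos (θ' i - θ' j) := by
    intro θ'
    have h1 : ∀ i, ∑ j, S.C i j * Real.cos (θ' i - θ' j)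
        * ((if i ∈ A then (1 : ℝ) else 0) * (if j ∈ Aᶜ then (1 : ℝ) else 0))
        = if i ∈ A then ∑ j ∈ Aᶜ, S.C i j * Real.cos (θ' i - θ' j) else 0 := by
      intro i
      by_cases hi : i ∈ A
      · simp only [hi, if_true, one_mul]
        rw [← Finset.sum_ite_mem_eq Aᶜ (fun j => S.C i j * Real.cos (θ' i - θ' j))]
        refine Finset.sum_congr rfl fun j _ => ?_
        split_ifs <;> simp
      · simp only [hi, if_false, zero_mul, mul_zero, Finset.sum_const_zero]
    rw [Finset.sum_congr rfl fun i _ => h1 i, Finset.sum_ite_mem_eq]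
  -- the swapped cross sum equals the first (symmetry of `C` and of `cos`)
  have hT2 : ∑ i, ∑ j, S.C i j * Real.cos (θ i - θ j)
      * ((if j ∈ A then (1 : ℝ) else 0) * (if i ∈ Aᶜ then (1 : ℝ) else 0))
      = ∑ i ∈ A, ∑ j ∈ Aᶜ, S.C i j * Real.cos (θ i - θ j) := by
    rw [Finset.sum_comm]
    rw [← hT θ]
    refine Finset.sum_congr rfl fun i _ => Finset.sum_congr rfl fun j _ => ?_
    rw [hC j i, ← Real.cos_neg, neg_sub]
  -- the bus term
  have hB : ∑ i, ∑ b, S.K i b * Real.cos (θ i - S.β b) * (if i ∈ A then (1 : ℝ) else 0) ^ 2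
      = ∑ i ∈ A, ∑ b, S.K i b * Real.cos (θ i - S.β b) := by
    rw [← Finset.sum_ite_mem_eq A]
    refine Finset.sum_congr rfl fun i _ => ?_
    split_ifs <;> simp
  have hmain : ∑ i, ∑ j, S.C i j * Real.cos (θ i - θ j)
      * ((if i ∈ A then (1 : ℝ) else 0) - (if j ∈ A then (1 : ℝ) else 0)) ^ 2
      = 2 * ∑ i ∈ A, ∑ j ∈ Aᶜ, S.C i j * Real.cos (θ i - θ j) := by
    have hsplit : ∑ i, ∑ j, S.C i j * Real.cos (θ i - θ j)
        * ((if i ∈ A then (1 : ℝ) else 0) - (if j ∈ A then (1 : ℝ) else 0)) ^ 2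
        = ∑ i, ∑ j, S.C i j * Real.cos (θ i - θ j)
            * ((if i ∈ A then (1 : ℝ) else 0) * (if j ∈ Aᶜ then (1 : ℝ) else 0))
          + ∑ i, ∑ j, S.C i j * Real.cos (θ i - θ j)
            * ((if j ∈ A then (1 : ℝ) else 0) * (if i ∈ Aᶜ then (1 : ℝ) else 0)) := by
      rw [← Finset.sum_add_distrib]
      refine Finset.sum_congr rfl fun i _ => ?_
      rw [← Finset.sum_add_distrib]
      refine Finset.sum_congr rfl fun j _ => ?_
      rw [hsq]
      ring
    rw [hsplit, hT θ, hT2]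
    ring
  rw [hmain, hB]
  ring

/-! ### §2. Taylor's Lemma 2.1 and its dynamic contrapositives -/

/-- **TAYLOR'S LEMMA 2.1** (as printed, `C` symmetric): if the Hesse form of the potential at `θ` is
positive semidefinite — the linear stability notion of the source («the matrix M is negative
semi-definite») — then EVERY cut of the network has nonnegative total residual capacity,
`Σ_{i∈A}Σ_{j∉A} Cᵢⱼ cos(θᵢ − θⱼ) + Σ_{i∈A}Σ_b Kᵢb cos(θᵢ − β_b) ≥ 0`.
[cite: TaylorKuramoto2012, §2 Lemma 2.1; DelabaysColettaJacquod2016, §4.3 Lemma 4.10] -/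
theorem cut_nonneg_of_hessForm_nonneg (hC : ∀ i j, S.C i j = S.C j i) {θ : Fin n → ℝ}
    (hpsd : ∀ v : Fin n → ℝ, 0 ≤ 1 / 2 * ∑ i, ∑ j, S.C i j * Real.cos (θ i - θ j) * (v i - v j) ^ 2
        + ∑ i, ∑ b, S.K i b * Real.cos (θ i - S.β b) * v i ^ 2) (A : Finset (Fin n)) :
    0 ≤ ∑ i ∈ A, ∑ j ∈ Aᶜ, S.C i j * Real.cos (θ i - θ j)
      + ∑ i ∈ A, ∑ b, S.K i b * Real.cos (θ i - S.β b) := by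
  rw [← S.hessForm_indicator hC θ A]
  exact hpsd _

/-- **A negative cut ⇒ the equilibrium is NOT a local minimum of the energy** (`C` symmetric, `θ` an
equilibrium; any number of buses): the indicator of `A` is a negative direction of the Hesse form
(`not_isLocalMin_potential_of_hessForm_neg`). «If we can partition the nodes … such that the sum of
cosines … is smaller than 0, then the solution is unstable.»
[cite: DelabaysColettaJacquod2016, §4.3 (after Lemma 4.10); TaylorKuramoto2012, §2 Lemma 2.1; ManikTimmeWitthaut2017, §5.2 proof of Cor. 2] -/
theorem not_isLocalMin_potential_of_negative_cut (hC : ∀ i j, S.C i j = S.C j i)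
    {θ : Fin n → ℝ} (hθ : S.IsEquilibrium θ) (A : Finset (Fin n))
    (hcut : ∑ i ∈ A, ∑ j ∈ Aᶜ, S.C i j * Real.cos (θ i - θ j)
      + ∑ i ∈ A, ∑ b, S.K i b * Real.cos (θ i - S.β b) < 0) :
    ¬ IsLocalMin S.potential θ := by
  refine S.not_isLocalMin_potential_of_hessForm_neg hC hθ (fun i => if i ∈ A then (1 : ℝ) else 0) ?_
  rw [S.hessForm_indicator hC θ A]
  exact hcut

/-- ★ **A negative cut at a NONDEGENERATE equilibrium ⇒ UNSTABLE rest point** (any number of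
infinite buses; `Mᵢ, Dᵢ > 0`, `C` symmetric; nondegenerate = the Hesse matrix has trivial kernel):
there is `ε > 0` such that from arbitrarily small perturbations of `(θe, 0)` some motion of the
damped swing model leaves the `ε`-ball (`unstable_rest_of_negativeDirection_of_nondegenerate` on the
indicator of `A`). [cite: TaylorKuramoto2012, §2 Lemma 2.1 (contrapositive); DelabaysColettaJacquod2016, §4.3; ManikTimmeWitthaut2017, §3 Lemma 1] -/
theorem unstable_rest_of_negative_cut_of_nondegenerate (hC : ∀ i j, S.C i j = S.C j i)
    (hM : ∀ i, 0 < S.M i) (hD : ∀ i, 0 < S.D i) {θe : Fin n → ℝ} (he : S.IsEquilibrium θe)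
    (hnd : ∀ v : Fin n → ℝ, S.hessMatrix θe *ᵥ v = 0 → v = 0) (A : Finset (Fin n))
    (hcut : ∑ i ∈ A, ∑ j ∈ Aᶜ, S.C i j * Real.cos (θe i - θe j)
      + ∑ i ∈ A, ∑ b, S.K i b * Real.cos (θe i - S.β b) < 0) :
    ∃ ε > 0, ∀ δ > 0, ∃ x₁ : (Fin n → ℝ) × (Fin n → ℝ), dist x₁ (θe, 0) < δ ∧
      ∀ X : ℝ → (Fin n → ℝ) × (Fin n → ℝ), X 0 = x₁ →
        (∀ T : ℝ, ∀ t ∈ Icc 0 T, HasDerivWithinAt X (S.field (X t)) (Icc 0 T) t) →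
        ∃ t, 0 ≤ t ∧ ε < dist (X t) (θe, 0) := by
  refine S.unstable_rest_of_negativeDirection_of_nondegenerate hC hM hD he hnd
    (fun i => if i ∈ A then (1 : ℝ) else 0) ?_
  rw [S.hessForm_indicator hC θe A]
  exact hcut

end AnyBus

section NoBus

variable {n : ℕ} (S : LosslessSystem n 0)

/-- Without infinite buses the indicator test reads `Q(θ; 1_A) = Σ_{i∈A}Σ_{j∉A} Cᵢⱼ cos(θᵢ − θⱼ)`.
[cite: TaylorKuramoto2012, §2 proof of Lemma 2.1] -/
theorem hessForm_indicator_noBus (hC : ∀ i j, S.C i j = S.C j i) (θ : Fin n → ℝ)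
    (A : Finset (Fin n)) :
    1 / 2 * ∑ i, ∑ j, S.C i j * Real.cos (θ i - θ j)
        * ((if i ∈ A then (1 : ℝ) else 0) - (if j ∈ A then (1 : ℝ) else 0)) ^ 2
      = ∑ i ∈ A, ∑ j ∈ Aᶜ, S.C i j * Real.cos (θ i - θ j) := by
  have h := S.hessForm_indicator hC θ A
  simpa only [Finset.univ_eq_empty, Finset.sum_empty, Finset.sum_const_zero, add_zero] using h

/-- ★ **A negative cut at a TRANSVERSALLY NONDEGENERATE synchronous state ⇒ UNSTABLE synchronous
solution** (no infinite bus; `Mᵢ, Dᵢ > 0`, `C` symmetric; synchronous state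
`Pₖ − Dₖω_s = flowₖ(θe)`, `ω_s = ΣP/ΣD`; nondegenerate = the kernel of the Hesse matrix is the
rotation only): there is `ε > 0` such that arbitrarily close to `θe` ON ITS MOMENTUM LEAF some motion
started at rest in the co-rotating frame leaves the `ε`-tube around the synchronous solution
(`unstable_syncSolution_of_negativeDirection_of_nondegenerate` on the indicator of `A`).
[cite: TaylorKuramoto2012, §2 Lemma 2.1 (contrapositive); DelabaysColettaJacquod2016, §4.3; ManikTimmeWitthaut2017, §3 Lemma 1] -/
theorem unstable_syncSolution_of_negative_cut_of_nondegenerate (hC : ∀ i j, S.C i j = S.C j i)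
    (hM : ∀ i, 0 < S.M i) (hD : ∀ i, 0 < S.D i) {θe : Fin n → ℝ}
    (he : ∀ k, S.P k - S.D k * ((∑ j, S.P j) / ∑ j, S.D j) = S.flow θe k)
    (hker : ∀ v : Fin n → ℝ, S.hessMatrix θe *ᵥ v = 0 → ∃ a : ℝ, v = fun _ => a)
    (A : Finset (Fin n))
    (hcut : ∑ i ∈ A, ∑ j ∈ Aᶜ, S.C i j * Real.cos (θe i - θe j) < 0) :
    ∃ ε > 0, ∀ δ > 0, ∃ θ₁ : Fin n → ℝ, dist θ₁ θe < δ ∧ ∑ k, S.D k * θ₁ k = ∑ k, S.D k * θe k ∧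
      ∀ X : ℝ → (Fin n → ℝ) × (Fin n → ℝ), X 0 = (θ₁, fun _ => (∑ j, S.P j) / ∑ j, S.D j) →
        (∀ T : ℝ, ∀ t ∈ Icc 0 T, HasDerivWithinAt X (S.field (X t)) (Icc 0 T) t) →
        ∃ t, 0 ≤ t ∧ ε < dist (X t)
          ((fun j => θe j + (∑ j, S.P j) / (∑ j, S.D j) * t), fun _ => (∑ j, S.P j) / ∑ j, S.D j) := by
  refine S.unstable_syncSolution_of_negativeDirection_of_nondegenerate hC hM hD he hker
    (fun i => if i ∈ A then (1 : ℝ) else 0) ?_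
  rw [S.hessForm_indicator_noBus hC θe A]
  exact hcut

end NoBus

end LosslessSystem

/-! ### §3. The ring: two lines with negative cosine cut an arc negatively -/

section Ring

variable {n : ℕ} (S : LosslessSystem (n + 1) 0) (Kv : Fin (n + 1) → ℝ)

/-- On a ring of at least three machines the two neighbours `ρ k` and `ρ⁻¹ k` of a node are
different (private copy of the plumbing of the ring files). [folklore] -/
private theorem rotate_ne_rotate_symm₄ (hn : 2 ≤ n) (k : Fin (n + 1)) :
    finRotate (n + 1) k ≠ (finRotate (n + 1)).symm k := by
  intro h
  set j := (finRotate (n + 1)).symm k with hj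
  have hk : finRotate (n + 1) j = k := by simp [hj]
  have h2 : finRotate (n + 1) (finRotate (n + 1) j) = j := by rw [hk]; exact h
  have hv1 : (finRotate (n + 1) j).val = if j = Fin.last n then 0 else j.val + 1 := coe_finRotate j
  have hv2 : (finRotate (n + 1) (finRotate (n + 1) j)).val
      = if finRotate (n + 1) j = Fin.last n then 0 else (finRotate (n + 1) j).val + 1 :=
    coe_finRotate _
  rw [h2] at hv2
  have hjlt : j.val < n + 1 := j.isLt
  by_cases hl : j = Fin.last n
  · have hjn : j.val = n := by rw [hl, Fin.val_last]
    rw [if_pos hl] at hv1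
    have hne : finRotate (n + 1) j ≠ Fin.last n := by
      intro h'
      have h'' := congrArg Fin.val h'
      rw [hv1, Fin.val_last] at h''
      omega
    rw [if_neg hne, hv1] at hv2
    omega
  · rw [if_neg hl] at hv1
    have hjn : j.val ≠ n := fun h' => hl (Fin.ext (by rw [h', Fin.val_last]))
    by_cases hl2 : finRotate (n + 1) j = Fin.last n
    · have h'' := congrArg Fin.val hl2
      rw [hv1, Fin.val_last] at h''
      rw [if_pos hl2] at hv2
      omega
    · rw [if_neg hl2, hv1] at hv2
      omega

/-- **Row structure of the ring coupling**: `Σⱼ C_{kj} g(j) = Kₖ g(ρk) + K_{ρ⁻¹k} g(ρ⁻¹k)` for any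
summand `g` (at least three machines). [cite: ManikTimmeWitthaut2017, §5.4 (ring R_N: nodes coupled to their two cyclic neighbours)] -/
theorem loadedRing_row_sum (hn : 2 ≤ n)
    (hC : ∀ i j, S.C i j = if j = finRotate (n + 1) i then Kv i
      else if i = finRotate (n + 1) j then Kv j else 0)
    (g : Fin (n + 1) → ℝ) (k : Fin (n + 1)) :
    ∑ j, S.C k j * g j = Kv k * g (finRotate (n + 1) k)
      + Kv ((finRotate (n + 1)).symm k) * g ((finRotate (n + 1)).symm k) := by
  have hab : finRotate (n + 1) k ≠ (finRotate (n + 1)).symm k := rotate_ne_rotate_symm₄ hn k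
  have hrow : ∀ j, S.C k j = (if j = finRotate (n + 1) k then Kv k else 0)
      + (if j = (finRotate (n + 1)).symm k then Kv j else 0) := by
    intro j
    rw [hC]
    have hiff : (k = finRotate (n + 1) j) ↔ (j = (finRotate (n + 1)).symm k) := by
      rw [Equiv.eq_symm_apply]
      exact eq_comm
    by_cases h1 : j = finRotate (n + 1) k
    · have h2 : j ≠ (finRotate (n + 1)).symm k := fun h => hab (h1.symm.trans h)
      rw [if_pos h1, if_pos h1, if_neg h2, add_zero]
    · rw [if_neg h1, if_neg h1, zero_add]
      by_cases h2 : j = (finRotate (n + 1)).symm k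
      · rw [if_pos (hiff.2 h2), if_pos h2]
      · rw [if_neg (fun h => h2 (hiff.1 h)), if_neg h2]
  simp only [hrow, add_mul, Finset.sum_add_distrib, ite_mul, zero_mul, Finset.sum_ite_eq',
    Finset.mem_univ, if_true]

/-- **On a ring the Hesse form is the sum over the LINES**:
`½ΣᵢΣⱼ Cᵢⱼ cos(θᵢ − θⱼ)(vᵢ − vⱼ)² = Σₖ Kₖ cos(θₖ − θ_{ρk})(vₖ − v_{ρk})²` (each line `(k, ρk)` is
counted from both ends in the double sum). [cite: ManikTimmeWitthaut2017, §3 (Hesse matrix of the ring) and §5.4; DelabaysColettaJacquod2016, §4.3] -/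
theorem loadedRing_hessForm_eq_edges (hn : 2 ≤ n)
    (hC : ∀ i j, S.C i j = if j = finRotate (n + 1) i then Kv i
      else if i = finRotate (n + 1) j then Kv j else 0)
    (θ v : Fin (n + 1) → ℝ) :
    1 / 2 * ∑ i, ∑ j, S.C i j * Real.cos (θ i - θ j) * (v i - v j) ^ 2
      = ∑ k, Kv k * Real.cos (θ k - θ (finRotate (n + 1) k)) * (v k - v (finRotate (n + 1) k)) ^ 2 := by
  have hrows : ∀ k, ∑ j, S.C k j * Real.cos (θ k - θ j) * (v k - v j) ^ 2
      = Kv k * (Real.cos (θ k - θ (finRotate (n + 1) k)) * (v k - v (finRotate (n + 1) k)) ^ 2)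
        + Kv ((finRotate (n + 1)).symm k) * (Real.cos (θ k - θ ((finRotate (n + 1)).symm k))
          * (v k - v ((finRotate (n + 1)).symm k)) ^ 2) := by
    intro k
    have h := loadedRing_row_sum S Kv hn hC (fun j => Real.cos (θ k - θ j) * (v k - v j) ^ 2) k
    rw [← h]
    exact Finset.sum_congr rfl fun j _ => by ring
  rw [Finset.sum_congr rfl fun k _ => hrows k, Finset.sum_add_distrib]
  -- reindex the second sum by `j = ρ⁻¹ k`
  have hre : ∑ k, Kv ((finRotate (n + 1)).symm k) * (Real.cos (θ k - θ ((finRotate (n + 1)).symm k))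
        * (v k - v ((finRotate (n + 1)).symm k)) ^ 2)
      = ∑ j, Kv j * (Real.cos (θ j - θ (finRotate (n + 1) j))
        * (v j - v (finRotate (n + 1) j)) ^ 2) := by
    rw [← Equiv.sum_comp (finRotate (n + 1)) (fun k => Kv ((finRotate (n + 1)).symm k)
      * (Real.cos (θ k - θ ((finRotate (n + 1)).symm k))
        * (v k - v ((finRotate (n + 1)).symm k)) ^ 2))]
    refine Finset.sum_congr rfl fun j _ => ?_
    simp only [Equiv.symm_apply_apply]
    rw [← Real.cos_neg, neg_sub]
    ring
  rw [hre, ← two_mul]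
  rw [← mul_assoc, show (1 / 2 : ℝ) * 2 = 1 by norm_num, one_mul]
  exact Finset.sum_congr rfl fun k _ => by ring

/-- **The arc from `ρk₁` to `k₂` is cut exactly by the lines `k₁` and `k₂`** (`k₁ ≠ k₂`): with
`A = {j : (j − ρk₁) mod N ≤ (k₂ − ρk₁) mod N}` (the nodes `ρk₁, ρ²k₁, …, k₂` along the cycle), the
indicator jump `(1_A(k) − 1_A(ρk))²` is `1` on the lines `k = k₁`, `k = k₂` and `0` on every other
line («removing these two lines splits the network in two parts, S and Sᶜ»).
[cite: DelabaysColettaJacquod2016, §4.3 (after Lemma 4.10)] -/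
theorem arc_indicator_sq {k₁ k₂ : Fin (n + 1)} (hk : k₁ ≠ k₂) {A : Finset (Fin (n + 1))}
    (hA : ∀ j, j ∈ A ↔ (j - finRotate (n + 1) k₁).val ≤ (k₂ - finRotate (n + 1) k₁).val) :
    ∀ k, ((if k ∈ A then (1 : ℝ) else 0) - (if finRotate (n + 1) k ∈ A then (1 : ℝ) else 0)) ^ 2
      = if k = k₁ ∨ k = k₂ then 1 else 0 := by
  -- notation: `c = ρ k₁`, `d = (k₂ − c) mod N`; `ρ x = x + 1`
  have hρ : ∀ x : Fin (n + 1), finRotate (n + 1) x = x + 1 := fun x => finRotate_apply x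
  set c := finRotate (n + 1) k₁ with hc
  have hc' : c = k₁ + 1 := hρ k₁
  set d := (k₂ - c).val with hd
  -- `d < n`: `d = n` would force `k₂ − c = −1`, i.e. `k₂ = k₁`
  have hneg1 : ((-1 : Fin (n + 1)) : ℕ) = n := Fin.coe_neg_one
  have hdn : d < n := by
    have hle : d ≤ n := by have := (k₂ - c).isLt; omega
    rcases lt_or_eq_of_le hle with h | h
    · exact h
    · exfalso
      have h1 : k₂ - c = -1 := Fin.ext (by rw [hneg1]; exact h)
      apply hk
      rw [hc'] at h1
      have h2 : k₂ = k₁ := by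
        calc k₂ = (k₂ - (k₁ + 1)) + (k₁ + 1) := by abel
          _ = -1 + (k₁ + 1) := by rw [h1]
          _ = k₁ := by abel
      exact h2.symm
  -- the successor shifts the offset by one: `(ρx − c) = (x − c) + 1`
  have hshift : ∀ x : Fin (n + 1), finRotate (n + 1) x - c = (x - c) + 1 := by
    intro x; rw [hρ x]; abel
  -- value of the shifted offset
  have hval_succ : ∀ y : Fin (n + 1), y.val < n → ((y + 1 : Fin (n + 1)) : ℕ) = y.val + 1 := by
    intro y hy
    exact Fin.val_add_one_of_lt (by rw [Fin.lt_def, Fin.val_last]; exact hy)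
  intro k
  set y := k - c with hy
  have hkA : k ∈ A ↔ y.val ≤ d := hA k
  have hρkA : finRotate (n + 1) k ∈ A ↔ ((y + 1 : Fin (n + 1)) : ℕ) ≤ d := by
    rw [hA, hshift k]
  by_cases h1 : k = k₁
  · -- the line `k₁`: `k₁ ∉ A` (offset `n > d`), `ρk₁ = c ∈ A` (offset `0`)
    rw [if_pos (Or.inl h1)]
    have hyv : y = -1 := by rw [hy, h1, hc']; abel
    have hyn : y.val = n := by rw [hyv, hneg1]
    have hk_out : k ∉ A := by rw [hkA, hyn]; omega
    have hρk_in : finRotate (n + 1) k ∈ A := by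
      rw [hρkA, hyv, neg_add_cancel, Fin.val_zero]
      exact Nat.zero_le _
    rw [if_neg hk_out, if_pos hρk_in]
    norm_num
  · by_cases h2 : k = k₂
    · -- the line `k₂`: `k₂ ∈ A` (offset `d`), `ρk₂ ∉ A` (offset `d + 1`)
      rw [if_pos (Or.inr h2)]
      have hyd : y.val = d := by rw [hy, h2]
      have hk_in : k ∈ A := by rw [hkA, hyd]
      have hρk_out : finRotate (n + 1) k ∉ A := by
        rw [hρkA, hval_succ y (by rw [hyd]; exact hdn), hyd]
        omega
      rw [if_pos hk_in, if_neg hρk_out]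
      norm_num
    · -- any other line: both ends on the same side
      rw [if_neg (not_or.2 ⟨h1, h2⟩)]
      have hyd : y.val ≠ d := by
        intro h
        apply h2
        have h3 : y = k₂ - c := Fin.ext (by rw [h])
        rw [hy] at h3
        exact sub_left_injective h3
      have hyn : y.val ≠ n := by
        intro h
        apply h1
        have h3 : y = -1 := Fin.ext (by rw [h, hneg1])
        rw [hy, hc'] at h3
        calc k = (k - (k₁ + 1)) + (k₁ + 1) := by abel
          _ = -1 + (k₁ + 1) := by rw [h3]
          _ = k₁ := by abel
      have hylt : y.val < n := by have := y.isLt; omega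
      rcases lt_or_gt_of_ne hyd with h | h
      · have hk_in : k ∈ A := by rw [hkA]; exact h.le
        have hρk_in : finRotate (n + 1) k ∈ A := by rw [hρkA, hval_succ y hylt]; omega
        rw [if_pos hk_in, if_pos hρk_in]
        norm_num
      · have hk_out : k ∉ A := by rw [hkA]; omega
        have hρk_out : finRotate (n + 1) k ∉ A := by rw [hρkA, hval_succ y hylt]; omega
        rw [if_neg hk_out, if_neg hρk_out]
        norm_num

/-- **The Hesse form of a ring on the indicator of the arc from `ρk₁` to `k₂` is the residual
capacity of the two cut lines**: `Q(θ; 1_A) = K_{k₁}cos(θ_{k₁} − θ_{ρk₁}) + K_{k₂}cos(θ_{k₂} − θ_{ρk₂})`.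
[cite: DelabaysColettaJacquod2016, §4.3 («removing these two lines splits the network in two parts, S and Sᶜ, such that Σ cos(Δᵢⱼ) < 0»)] -/
theorem loadedRing_hessForm_indicator_arc (hn : 2 ≤ n)
    (hC : ∀ i j, S.C i j = if j = finRotate (n + 1) i then Kv i
      else if i = finRotate (n + 1) j then Kv j else 0)
    (θ : Fin (n + 1) → ℝ) {k₁ k₂ : Fin (n + 1)} (hk : k₁ ≠ k₂) {A : Finset (Fin (n + 1))}
    (hA : ∀ j, j ∈ A ↔ (j - finRotate (n + 1) k₁).val ≤ (k₂ - finRotate (n + 1) k₁).val) :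
    1 / 2 * ∑ i, ∑ j, S.C i j * Real.cos (θ i - θ j)
        * ((if i ∈ A then (1 : ℝ) else 0) - (if j ∈ A then (1 : ℝ) else 0)) ^ 2
      = Kv k₁ * Real.cos (θ k₁ - θ (finRotate (n + 1) k₁))
        + Kv k₂ * Real.cos (θ k₂ - θ (finRotate (n + 1) k₂)) := by
  rw [loadedRing_hessForm_eq_edges S Kv hn hC θ (fun i => if i ∈ A then (1 : ℝ) else 0)]
  rw [Finset.sum_congr rfl fun k _ => by rw [arc_indicator_sq hk hA k]]
  have hsplit : ∀ k : Fin (n + 1), (if k = k₁ ∨ k = k₂ then (1 : ℝ) else 0)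
      = (if k = k₁ then (1 : ℝ) else 0) + (if k = k₂ then (1 : ℝ) else 0) := by
    intro k
    by_cases h1 : k = k₁
    · have h2 : k ≠ k₂ := fun h => hk (h1.symm.trans h)
      rw [if_pos (Or.inl h1), if_pos h1, if_neg h2, add_zero]
    · by_cases h2 : k = k₂
      · rw [if_pos (Or.inr h2), if_neg h1, if_pos h2, zero_add]
      · rw [if_neg (not_or.2 ⟨h1, h2⟩), if_neg h1, if_neg h2, add_zero]
  simp only [hsplit, mul_add, Finset.sum_add_distrib, mul_ite, mul_one, mul_zero,
    Finset.sum_ite_eq', Finset.mem_univ, if_true]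

/-- ★ **Two lines with negative cosine ⇒ the synchronous state is NOT a local minimum of the
energy** (ring of `N ≥ 3` machines, positive capacities, `θ` an equilibrium of `S` — apply to the
co-rotating system for a loaded ring): the arc between the two lines is a negative cut.
[cite: DelabaysColettaJacquod2016, §4.3 («We conclude that there is at most a single |Δ_{i,i+1}| > π/2»); TaylorKuramoto2012, §2 Lemma 2.1] -/
theorem loadedRing_not_isLocalMin_of_two_negative_lines (hn : 2 ≤ n) (hK : ∀ k, 0 < Kv k)
    (hC : ∀ i j, S.C i j = if j = finRotate (n + 1) i then Kv i
      else if i = finRotate (n + 1) j then Kv j else 0)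
    {θ : Fin (n + 1) → ℝ} (hθ : S.IsEquilibrium θ) {k₁ k₂ : Fin (n + 1)} (hk : k₁ ≠ k₂)
    (h₁ : Real.cos (θ k₁ - θ (finRotate (n + 1) k₁)) < 0)
    (h₂ : Real.cos (θ k₂ - θ (finRotate (n + 1) k₂)) < 0) :
    ¬ IsLocalMin S.potential θ := by
  set A : Finset (Fin (n + 1)) := Finset.univ.filter
    (fun j => (j - finRotate (n + 1) k₁).val ≤ (k₂ - finRotate (n + 1) k₁).val) with hAdef
  have hA : ∀ j, j ∈ A ↔ (j - finRotate (n + 1) k₁).val ≤ (k₂ - finRotate (n + 1) k₁).val := by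
    intro j
    rw [hAdef, Finset.mem_filter]
    simp
  refine S.not_isLocalMin_potential_of_hessForm_neg (loadedRing_C_symm S Kv hn hC) hθ
    (fun i => if i ∈ A then (1 : ℝ) else 0) ?_
  simp only [Finset.univ_eq_empty, Finset.sum_empty, Finset.sum_const_zero, add_zero]
  rw [loadedRing_hessForm_indicator_arc S Kv hn hC θ hk hA]
  have := mul_neg_of_pos_of_neg (hK k₁) h₁
  have := mul_neg_of_pos_of_neg (hK k₂) h₂
  linarith

/-- ★★ **DELABAYS–COLETTA–JACQUOD: a stable synchronous state of a single-loop network has AT MOST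
ONE line with `|θᵢ − θⱼ| > π/2` — in contrapositive, census-free, for the motions.** Loaded ring of
`N = n + 1 ≥ 3` machines with positive capacities `Kₖ` on the lines `(k, ρk)`, arbitrary
injections, `Mᵢ, Dᵢ > 0`; `θe` a synchronous state (`Pₖ − Dₖω_s = flowₖ(θe)`) whose Hesse matrix is
nondegenerate transversally to the rotation. If TWO distinct lines `k₁ ≠ k₂` have
`cos(θe_{k} − θe_{ρk}) < 0`, then the synchronous solution through `θe` is UNSTABLE: there is `ε > 0`
such that arbitrarily close to `θe` on its momentum leaf some motion started at rest in the
co-rotating frame leaves the `ε`-tube around it (Taylor's cut `A` = the arc from `ρk₁` to `k₂`,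
`Q(1_A) = K_{k₁}cos₁ + K_{k₂}cos₂ < 0`, then `unstable_syncSolution_of_negative_cut_of_nondegenerate`).
THREE COLUMNS: CERTIFIED for MODEL `M` = damped lossless swing model on a ring (MV-1); «unstable» =
the synchronous SOLUTION of MODEL `M`; the degenerate case is not decided.
[cite: DelabaysColettaJacquod2016, §4.3 Lemma 4.10 and the following paragraph; TaylorKuramoto2012, §2 Lemma 2.1; ManikTimmeWitthaut2017, §3 Lemma 1] -/
theorem loadedRing_unstable_syncSolution_of_two_negative_lines (hn : 2 ≤ n) (hK : ∀ k, 0 < Kv k)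
    (hC : ∀ i j, S.C i j = if j = finRotate (n + 1) i then Kv i
      else if i = finRotate (n + 1) j then Kv j else 0)
    (hM : ∀ i, 0 < S.M i) (hD : ∀ i, 0 < S.D i) {θe : Fin (n + 1) → ℝ}
    (he : ∀ k, S.P k - S.D k * ((∑ j, S.P j) / ∑ j, S.D j) = S.flow θe k)
    (hker : ∀ v : Fin (n + 1) → ℝ, S.hessMatrix θe *ᵥ v = 0 → ∃ a : ℝ, v = fun _ => a)
    {k₁ k₂ : Fin (n + 1)} (hk : k₁ ≠ k₂)
    (h₁ : Real.cos (θe k₁ - θe (finRotate (n + 1) k₁)) < 0)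
    (h₂ : Real.cos (θe k₂ - θe (finRotate (n + 1) k₂)) < 0) :
    ∃ ε > 0, ∀ δ > 0, ∃ θ₁ : Fin (n + 1) → ℝ, dist θ₁ θe < δ ∧
      ∑ k, S.D k * θ₁ k = ∑ k, S.D k * θe k ∧
      ∀ X : ℝ → (Fin (n + 1) → ℝ) × (Fin (n + 1) → ℝ),
        X 0 = (θ₁, fun _ => (∑ j, S.P j) / ∑ j, S.D j) →
        (∀ T : ℝ, ∀ t ∈ Icc 0 T, HasDerivWithinAt X (S.field (X t)) (Icc 0 T) t) →
        ∃ t, 0 ≤ t ∧ ε < dist (X t)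
          ((fun j => θe j + (∑ j, S.P j) / (∑ j, S.D j) * t), fun _ => (∑ j, S.P j) / ∑ j, S.D j) := by
  set A : Finset (Fin (n + 1)) := Finset.univ.filter
    (fun j => (j - finRotate (n + 1) k₁).val ≤ (k₂ - finRotate (n + 1) k₁).val) with hAdef
  have hA : ∀ j, j ∈ A ↔ (j - finRotate (n + 1) k₁).val ≤ (k₂ - finRotate (n + 1) k₁).val := by
    intro j
    rw [hAdef, Finset.mem_filter]
    simp
  have hCs := loadedRing_C_symm S Kv hn hC
  refine S.unstable_syncSolution_of_negative_cut_of_nondegenerate hCs hM hD he hker A ?_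
  rw [← S.hessForm_indicator_noBus hCs θe A, loadedRing_hessForm_indicator_arc S Kv hn hC θe hk hA]
  have := mul_neg_of_pos_of_neg (hK k₁) h₁
  have := mul_neg_of_pos_of_neg (hK k₂) h₂
  linarith

end Ring

end ClassicalModel

end Literature.MathematicalPhysics.PowerSystems

end
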